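import Literature.AlgebraicGeometry.Motives.ZarhinHodgeGroupBlocks
import HarnessLib

/-!
# An operator commuting with the Hodge Lie algebra preserves the eigenblocks of the endomorphism algebra; no block is carried into another

Pure Hodge structures `H` of weight `n` on a finite-dimensional `ℚ`-space `V`; `E = End_Hdg(V)`
(`H.endAlg`), the blocks `T_σ = H.eigenBlock σ ⊆ V_ℂ` of the characters `σ : E → ℂ`
(`Motives/ZarhinHodgeGroupBlocks`), `𝔥 = hodgeLie H`, `𝔥_ℂ = hodgeLieC H`. Proved here:

* `eigenBlock_disjoint` — `T_σ ⊓ T_τ = 0` for `σ ≠ τ`;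
* `baseChange_endAlg_apply_mem_eigenBlock` — every `a_ℂ`, `a ∈ E`, preserves every block (it is
  the scalar `σ(a)` there), hence so does every element of `span_ℂ {a_ℂ}`
  (`apply_mem_eigenBlock_of_mem_span_endAlg`);
* **`apply_mem_eigenBlock_of_forall_commute`** — a `ℂ`-linear `T` on `V_ℂ` commuting with all
  `X_ℂ`, `X ∈ 𝔥`, preserves every block: by the tree's commutant theorem
  `mem_span_endAlg_of_forall_commute` ("the commutant of `Hdg` is `End_Hdg ⊗ ℂ`", Zarhin §2 /
  Huybrechts p. 66 / Deligne I §3) `T ∈ span_ℂ {a_ℂ : a ∈ E}`;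
* **`eq_zero_of_forall_commute_of_mapsTo_eigenBlock`** — consequently, if such a `T` carries
  `T_σ` into `T_τ` with `σ ≠ τ`, then `T = 0` on `T_σ`: NO NON-ZERO INTERTWINER BETWEEN DISTINCT
  BLOCKS COMMUTES WITH `𝔥`. This is hypothesis (b) ("no graph position") of the tree's
  `RepresentationTheory/GeneralLinear/Sl2PlacesRationalHull` in invariant form: for an abelian
  variety with `End⁰(X) = E` totally real of degree `dim X`, a conjugation `g` with
  `σ_i(Y) = g σ_k(Y) g⁻¹` for all `Y ∈ 𝔥` would be such an intertwiner `T_{σ_k} → T_{σ_i}`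
  (Hazama 1983 §3: the `𝔥`-modules `V_i` are "mutually non-isomorphic" because
  `End_{Hg}(H¹) = End⁰(X)`; Moonen–Zarhin 1999 Lemma (3.4)).

Research context (cell `pub-hodge-ring2`, Literature lane, real-multiplication programme R2a): a
route conditional on HC_CM; this file is unconditional and no step towards a summit statement. No
definition, no named fact (D-0026); axioms standard.

## References

* [Zarhin1983HodgeGroupsK3] Yu. G. Zarhin, *Hodge groups of K3 surfaces*, J. reine angew. Math.
  341 (1983), §2 (commutant of the Hodge group; `T_σ` pairwise non-isomorphic). [cite: Zarhin1983HodgeGroupsK3, §2]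
* [Huybrechts2016K3] D. Huybrechts, *Lectures on K3 Surfaces* (CUP 2016), §3.3.4 p. 66 and
  Rem. 3.3.14 (iii). [cite: Huybrechts2016K3, §3.3.4 and Rem. 3.3.14 (iii)]
* [Hazama1983] F. Hazama, Tôhoku Math. J. 35 (1983) 303–308, §3 p. 305 ("`V_i` … mutually
  non-isomorphic `𝔥`-modules"). [cite: Hazama1983, §3]
* [MoonenZarhin1999LowDim] B. Moonen, Yu. Zarhin, Math. Ann. 315 (1999), Lemma (3.4). [cite: MoonenZarhin1999LowDim, Lemma (3.4)]
-/

noncomputable section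

open scoped TensorProduct

namespace Literature.AlgebraicGeometry.Motives

namespace HodgeStructure

universe u

variable {V : Type u} [AddCommGroup V] [Module ℚ V] [Module.Finite ℚ V] [HodgeTensorFacts.{u, u}]
  {n : ℤ}

omit [Module.Finite ℚ V] [HodgeTensorFacts.{u, u}] in
/-- **Distinct blocks are disjoint**: `T_σ ⊓ T_τ = 0` for `σ ≠ τ` (on a common vector some `a ∈ E`
acts by two different scalars). [cite: Huybrechts2016K3, Rem. 3.3.14 (iii)] -/
theorem eigenBlock_disjoint (H : HodgeStructure V n) {σ τ : H.endAlg →+* ℂ} (hστ : σ ≠ τ)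
    {x : ℂ ⊗[ℚ] V} (hσ : x ∈ H.eigenBlock σ) (hτ : x ∈ H.eigenBlock τ) : x = 0 := by
  obtain ⟨a, ha⟩ : ∃ a : H.endAlg, σ a ≠ τ a := by
    by_contra h
    push Not at h
    exact hστ (RingHom.ext h)
  rw [mem_eigenBlock_iff] at hσ hτ
  have h := (hσ a).symm.trans (hτ a)
  rw [← sub_eq_zero, ← sub_smul, smul_eq_zero] at h
  exact h.resolve_left (sub_ne_zero.2 ha)

omit [Module.Finite ℚ V] [HodgeTensorFacts.{u, u}] in
/-- Every `a_ℂ`, `a ∈ End_Hdg(V)`, preserves every block (it acts there by the scalar `σ(a)`).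
[cite: Huybrechts2016K3, Rem. 3.3.14 (iii)] -/
theorem baseChange_endAlg_apply_mem_eigenBlock (H : HodgeStructure V n) (σ : H.endAlg →+* ℂ)
    (a : H.endAlg) {x : ℂ ⊗[ℚ] V} (hx : x ∈ H.eigenBlock σ) :
    (a : Module.End ℚ V).baseChange ℂ x ∈ H.eigenBlock σ := by
  rw [(H.mem_eigenBlock_iff σ x).1 hx a]
  exact Submodule.smul_mem _ _ hx

omit [Module.Finite ℚ V] [HodgeTensorFacts.{u, u}] in
/-- Every element of `span_ℂ {a_ℂ : a ∈ End_Hdg(V)} = End_Hdg(V) ⊗ ℂ` preserves every block.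
[cite: Huybrechts2016K3, Rem. 3.3.14 (iii)] -/
theorem apply_mem_eigenBlock_of_mem_span_endAlg (H : HodgeStructure V n) (σ : H.endAlg →+* ℂ)
    {T : Module.End ℂ (ℂ ⊗[ℚ] V)}
    (hT : T ∈ Submodule.span ℂ ((fun a : Module.End ℚ V => a.baseChange ℂ) '' (H.endAlg : Set _)))
    {x : ℂ ⊗[ℚ] V} (hx : x ∈ H.eigenBlock σ) : T x ∈ H.eigenBlock σ := by
  induction hT using Submodule.span_induction with
  | mem Z hZ =>
    obtain ⟨a, ha, rfl⟩ := hZ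
    exact H.baseChange_endAlg_apply_mem_eigenBlock σ ⟨a, ha⟩ hx
  | zero => rw [LinearMap.zero_apply]; exact Submodule.zero_mem _
  | add Z Z' _ _ hZ hZ' => rw [LinearMap.add_apply]; exact Submodule.add_mem _ hZ hZ'
  | smul c Z _ hZ => rw [LinearMap.smul_apply]; exact Submodule.smul_mem _ c hZ

/-- **An operator on `V_ℂ` commuting with `Lie Hdg` preserves every block** (`T ∈ End_Hdg ⊗ ℂ` by
the commutant theorem `mem_span_endAlg_of_forall_commute`). [cite: Zarhin1983HodgeGroupsK3, §2]
[cite: Huybrechts2016K3, §3.3.4 (p. 66)] -/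
theorem apply_mem_eigenBlock_of_forall_commute (H : HodgeStructure V n) (σ : H.endAlg →+* ℂ)
    {T : Module.End ℂ (ℂ ⊗[ℚ] V)}
    (hT : ∀ X ∈ H.hodgeLie, T * X.baseChange ℂ = X.baseChange ℂ * T)
    {x : ℂ ⊗[ℚ] V} (hx : x ∈ H.eigenBlock σ) : T x ∈ H.eigenBlock σ :=
  H.apply_mem_eigenBlock_of_mem_span_endAlg σ (H.mem_span_endAlg_of_forall_commute hT) hx

/-- **No non-zero intertwiner between distinct blocks commutes with `Lie Hdg`.** If `T` commutes
with every `X_ℂ`, `X ∈ Lie Hdg(H)`, and carries the block `T_σ` into the block `T_τ` with `σ ≠ τ`,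
then `T` vanishes on `T_σ` (it also preserves `T_σ`, and `T_σ ⊓ T_τ = 0`). Hypothesis (b) of
`Sl2PlacesRationalHull` for Hodge structures with `End_Hdg = E` a field: the blocks are pairwise
non-isomorphic `Lie Hdg`-modules (Hazama 1983 §3; Moonen–Zarhin 1999 Lemma (3.4); Zarhin §2).
[cite: Hazama1983, §3] [cite: MoonenZarhin1999LowDim, Lemma (3.4)] [cite: Zarhin1983HodgeGroupsK3, §2] -/
theorem eq_zero_of_forall_commute_of_mapsTo_eigenBlock (H : HodgeStructure V n)
    {σ τ : H.endAlg →+* ℂ} (hστ : σ ≠ τ) {T : Module.End ℂ (ℂ ⊗[ℚ] V)}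
    (hT : ∀ X ∈ H.hodgeLie, T * X.baseChange ℂ = X.baseChange ℂ * T)
    (hmaps : ∀ x ∈ H.eigenBlock σ, T x ∈ H.eigenBlock τ) {x : ℂ ⊗[ℚ] V}
    (hx : x ∈ H.eigenBlock σ) : T x = 0 :=
  H.eigenBlock_disjoint hστ (H.apply_mem_eigenBlock_of_forall_commute σ hT hx) (hmaps x hx)

/-- The same for an operator commuting with the COMPLEXIFIED Lie algebra `𝔥_ℂ` (it then commutes
with the `X_ℂ`, `X ∈ 𝔥`, which lie in `𝔥_ℂ`). [cite: Zarhin1983HodgeGroupsK3, §2] -/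
theorem eq_zero_of_forall_commute_hodgeLieC_of_mapsTo_eigenBlock (H : HodgeStructure V n)
    {σ τ : H.endAlg →+* ℂ} (hστ : σ ≠ τ) {T : Module.End ℂ (ℂ ⊗[ℚ] V)}
    (hT : ∀ Y ∈ H.hodgeLieC, T * Y = Y * T)
    (hmaps : ∀ x ∈ H.eigenBlock σ, T x ∈ H.eigenBlock τ) {x : ℂ ⊗[ℚ] V}
    (hx : x ∈ H.eigenBlock σ) : T x = 0 :=
  H.eq_zero_of_forall_commute_of_mapsTo_eigenBlock hστ
    (fun _ hX => hT _ (H.baseChange_mem_hodgeLieC hX)) hmaps hx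

end HodgeStructure

end Literature.AlgebraicGeometry.Motives

end
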